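import Mathlib
import Summits.Ventures.PercRepro2.SwOutAdjThm

/-!
# The blocks of a region with adjacent junctions, core form (blind cell PercRepro2, night-4 g32,
2026-08-28; proofs/NIGHT4-G32.md §2)

Night-4 g11's block lemmas (SwOutAdjBlock) are stated for a configuration `ζ₁` of the principal
side `swOutSide`; they use the side only through two facts — `ζ₁` lies in the class `outClass`,
and the cores of `ζ₁` lie in `{h} ∪ J`.  This file restates them with exactly those two hypotheses
(`hcl₁`, `hcore₁`), so that the block structure «arms of the graph split at the matched set ⊕
internal edges» serves every side whose cores are `h` or junctions: the principal side
(`core_mem_J_of_out`) and g7's general doubly typed side (`core_mem_J_of_out_g`, g31).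
Every proof is g11's with the two hypotheses in place of `hout` / `hζ₁`.
-/

namespace Summit.Ventures.PercRepro2

namespace LocRows

open Hull

variable {V : Type*} {E : Type*} [Fintype E] [DecidableEq E]

open scoped Classical

section BlockCore

variable {ends : E → Sym2 V} {U : Set V} {ξ : Config E} {h : V} {J : Set V}

variable (hJU : J ⊆ U) (hhJ : h ∉ J)
  (hadj : ∀ u ∈ J, ∀ e (he : u ∈ ends e), Sym2.Mem.other he ≠ h →
    ∃ e', ends e' = s(Sym2.Mem.other he, h))

variable {ζ₁ : Config E} (hcl₁ : ζ₁ ∈ outClass ends U h ξ)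
  (hcore₁ : ∀ x, x ∈ cluster ends ζ₁ h → x ∈ cluster ends (blue ζ₁) h → x = h ∨ x ∈ J)

omit [Fintype E] [DecidableEq E] in
include hhJ hadj hcore₁ in
/-- A configuration whose cores lie in `{h} ∪ J` is fine for its matched set. -/
theorem afine_aSet_core : AFine ends (aSet ends J h ζ₁) h ζ₁ :=
  afine_aSet hhJ hadj hcore₁

omit [Fintype E] [DecidableEq E] in
include hhJ hcore₁ in
/-- A configuration whose cores lie in `{h} ∪ J` is core-free in the graph split at its matched
set. -/
theorem coreFree_split_aSet_core :
    CoreFree (splitEndsS ends (aSet ends J h ζ₁)) ζ₁ (Sum.inl h) :=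
  coreFree_split_aSet hhJ hcore₁

omit [Fintype E] [DecidableEq E] in
include hhJ hcore₁ in
/-- `normRed ζ₁` is core-free in the split graph. -/
lemma coreFree_normRed_core :
    CoreFree (splitEndsS ends (aSet ends J h ζ₁)) (normRed ends (aSet ends J h ζ₁) ζ₁)
      (Sum.inl h) :=
  coreFree_splitS_congr (fun e hi => (normRed_agree ζ₁ e hi).symm) _
    (coreFree_split_aSet_core hhJ hcore₁)

omit [Fintype E] [DecidableEq E] in
include hhJ hcore₁ in
/-- The base point is core-free in the split graph. -/
lemma coreFree_blockBase_core :
    CoreFree (splitEndsS ends (aSet ends J h ζ₁)) (blockBase ends (aSet ends J h ζ₁) h ζ₁)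
      (Sum.inl h) :=
  coreFree_allRed (coreFree_normRed_core hhJ hcore₁)

omit [DecidableEq E] in
include hhJ hcore₁ in
/-- Every block point has the split hull of `ζ₁`. -/
theorem hull_blockReal_core (ω : Config (BlockIdx ends (aSet ends J h ζ₁) h ζ₁)) :
    hull (splitEndsS ends (aSet ends J h ζ₁)) (blockReal ends (aSet ends J h ζ₁) h ζ₁ ω)
        (Sum.inl h) =
      hull (splitEndsS ends (aSet ends J h ζ₁)) ζ₁ (Sum.inl h) := by
  rw [hull_splitS_congr (blockReal_agree ω), hull_orbitReal (coreFree_blockBase_core hhJ hcore₁),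
    blockBase, hull_allRed (coreFree_normRed_core hhJ hcore₁),
    hull_splitS_congr (normRed_agree ζ₁)]

omit [DecidableEq E] in
include hhJ hadj hcore₁ in
/-- Every block point is fine for the matched set of `ζ₁`. -/
theorem afine_blockReal_core (ω : Config (BlockIdx ends (aSet ends J h ζ₁) h ζ₁)) :
    AFine ends (aSet ends J h ζ₁) h (blockReal ends (aSet ends J h ζ₁) h ζ₁ ω) := by
  intro e he hi
  rw [hull_blockReal_core hhJ hcore₁]
  exact afine_aSet_core hhJ hadj hcore₁ e he hi

omit [DecidableEq E] in
include hhJ hcore₁ in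
/-- Every block point is core-free in the split graph. -/
theorem coreFree_blockReal_core (ω : Config (BlockIdx ends (aSet ends J h ζ₁) h ζ₁)) :
    CoreFree (splitEndsS ends (aSet ends J h ζ₁)) (blockReal ends (aSet ends J h ζ₁) h ζ₁ ω)
      (Sum.inl h) :=
  coreFree_splitS_congr (fun e hi => (blockReal_agree ω e hi).symm) _
    (coreFree_orbitReal (coreFree_blockBase_core hhJ hcore₁) _)

omit [DecidableEq E] in
include hhJ hadj hcore₁ in
/-- **The matched set is constant on the block.** -/
theorem aSet_blockReal_core (ω : Config (BlockIdx ends (aSet ends J h ζ₁) h ζ₁)) :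
    aSet ends J h (blockReal ends (aSet ends J h ζ₁) h ζ₁ ω) = aSet ends J h ζ₁ := by
  have hhM : h ∉ aSet ends J h ζ₁ := fun h' => hhJ (aSet_subset h')
  have hfη : AFine ends (aSet ends J h ζ₁) h (blockReal ends (aSet ends J h ζ₁) h ζ₁ ω) :=
    afine_blockReal_core hhJ hadj hcore₁ ω
  have hf₁ : AFine ends (aSet ends J h ζ₁) h ζ₁ := afine_aSet_core hhJ hadj hcore₁
  have hc₁ := coreFree_normRed_core hhJ hcore₁
  have hc₀ := coreFree_blockBase_core hhJ hcore₁
  -- the matched set of `ζ₁` is good for the block point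
  have hMη : aSet ends J h ζ₁ ⊆ aSet ends J h (blockReal ends (aSet ends J h ζ₁) h ζ₁ ω) :=
    subset_aSet_of_good ⟨aSet_subset, fun _ hu _ hue hi => edgeMatched_of_afine hfη hu hue hi⟩
  apply Set.Subset.antisymm _ hMη
  -- the matched set of the block point is good for `ζ₁`
  refine subset_aSet_of_good ⟨aSet_subset, ?_⟩
  intro u hu e hue hi
  have hmη : EdgeMatched ends h (blockReal ends (aSet ends J h ζ₁) h ζ₁ ω) e :=
    edgeMatched_of_mem_aSet hu hue hi
  by_cases hM' : ∃ w ∈ aSet ends J h ζ₁, w ∈ ends e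
  · obtain ⟨w, hwM, hwe⟩ := hM'
    have hiM : ¬ Internal ends (aSet ends J h ζ₁) e := fun hi' => hi (hi'.mono hMη)
    exact edgeMatched_of_mem_aSet (η := ζ₁) hwM hwe hiM
  · push Not at hM'
    have he : ∀ z ∈ ends e, z ∉ aSet ends J h ζ₁ := fun z hz hzM => hM' z hzM hz
    have hiM : ¬ Internal ends (aSet ends J h ζ₁) e := fun hi' => hM' u (hi' u hue) hue
    rw [← edgeMatched_splitS_iff hhM hf₁ he]
    rw [← edgeMatched_splitS_iff hhM hfη he] at hmη
    -- transfer along the two arm flips back to `normRed ζ₁`, then to `ζ₁`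
    have h1 : EdgeMatched (splitEndsS ends (aSet ends J h ζ₁)) (Sum.inl h)
        (orbitReal (splitEndsS ends (aSet ends J h ζ₁)) (blockBase ends (aSet ends J h ζ₁) h ζ₁)
          (Sum.inl h) (ω ∘ Sum.inl)) e := by
      obtain ⟨hm1, hm2⟩ := hmη
      rw [cluster_splitS_congr (blockReal_agree ω)] at hm1
      rw [cluster_blue_splitS_congr (blockReal_agree ω)] at hm2
      rw [blockReal_agree ω e hiM] at hm1 hm2
      exact ⟨hm1, hm2⟩
    have h2 := edgeMatched_of_edgeMatched_flip (coreFree_allRed hc₀)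
      (armClosed_armsFalse_allRed hc₀ (ω ∘ Sum.inl)) h1
    rw [blockBase, allRed_idem hc₁] at h2
    have h3 := edgeMatched_of_edgeMatched_flip hc₁ (armClosed_blueSide hc₁) h2
    obtain ⟨hm1, hm2⟩ := h3
    rw [cluster_splitS_congr (normRed_agree ζ₁)] at hm1
    rw [cluster_blue_splitS_congr (normRed_agree ζ₁)] at hm2
    rw [normRed_agree ζ₁ e hiM] at hm1 hm2
    exact ⟨hm1, hm2⟩

include hJU hhJ hcl₁ hcore₁ in
/-- The base point lies in the class of the split graph. -/
lemma blockBase_mem_outClass_core :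
    blockBase ends (aSet ends J h ζ₁) h ζ₁ ∈
      outClass (splitEndsS ends (aSet ends J h ζ₁)) (splitRegionS U) (Sum.inl h) ξ := by
  have hMU : aSet ends J h ζ₁ ⊆ U := fun u hu => hJU (aSet_subset hu)
  have hcl := mem_outClass_splitS_of_mem' (h := h) hMU hcl₁
  have hcln := mem_outClass_splitS_congr (fun e hi => (normRed_agree ζ₁ e hi).symm) hcl
  exact allRed_mem_outClass hcln (coreFree_normRed_core hhJ hcore₁)

include hJU hhJ hadj hcl₁ hcore₁ in
/-- Every block point lies in the class. -/
theorem blockReal_mem_outClass_core (ω : Config (BlockIdx ends (aSet ends J h ζ₁) h ζ₁)) :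
    blockReal ends (aSet ends J h ζ₁) h ζ₁ ω ∈ outClass ends U h ξ := by
  have hMU : aSet ends J h ζ₁ ⊆ U := fun u hu => hJU (aSet_subset hu)
  have hhM : h ∉ aSet ends J h ζ₁ := fun h' => hhJ (aSet_subset h')
  refine mem_outClass_of_mem_splitS' hMU hhM (afine_blockReal_core hhJ hadj hcore₁ ω) ?_
  refine mem_outClass_splitS_congr (fun e hi => (blockReal_agree ω e hi).symm) ?_
  exact orbitReal_mem_outClass (coreFree_blockBase_core hhJ hcore₁)
    (blockBase_mem_outClass_core hJU hhJ hcl₁ hcore₁) _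

end BlockCore

end LocRows

end Summit.Ventures.PercRepro2
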